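import Mathlib
import HarnessLib
import Summits.ValiantsHypothesis.ValiantsHypothesis.Theorems.LacunarySymmetroidMatrixDescartesProductPlusOneRealRootedKernel

/-!
# LINE (A) `product_plus_one` (crux `MatrixDescartes`, stmt-ValiantsHypothesis-18050, V1) — EB2-W, RUNG R (the REAL-ROOTED LAW), part 1b:
# the ROOT KERNEL `F(x) = Σ_i w_i ρ_i/(x − ρ_i)²` has NO THREE ZEROS per inner window and NO TWO per outer window

Continuation of ✓ `…RealRootedKernel` (owner memo §17, CLAIM R; elementary replacement of the Laplace sign rule).  Weights `w_i > 0`, roots `ρ_i`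
(repeats allowed), `F(x) = Σ_{i∈s} w_iρ_i/(x−ρ_i)²`, `F′ = −2Σ w_iρ_i/(x−ρ_i)³`:

* `no_three_zeros_of_strictMonoOn_exp_mul_deriv`, `no_two_zeros_of_injOn_exp_mul` — counting shells (Rolle twice / injectivity);
* ★ `rootKernel_inner_no_three_zeros` — INNER window `(a,b)` (`0 < a < b`, every root `≤ a` or `≥ b`, a positive root `≤ a`, a root `≥ b`):
  with the shift `σ` of ✓ `exists_sigma` for the left roots, `F″ + σF′ = Σ_i w_iρ_i(6 − 2σ(x−ρ_i))/(x−ρ_i)⁴ > 0` on the window (left part `≥ 0` by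
  ✓ `key2_sum`, right part `> 0` termwise), so `e^{σx}F′` is strictly increasing and `F` has no three zeros;
* ★ `rootKernel_leftOuter_no_two_zeros` — `(0,b)`, every root `≤ 0` or `≥ b`, some root `≠ 0`: `F′ > 0` termwise, `F` strictly increasing;
* ★ `rootKernel_rightOuter_no_two_zeros` — `(a,∞)`, every root `≤ a`, some root positive: `F′ + σF = Σ_i w_iρ_i(σ(x−ρ_i) − 2)/(x−ρ_i)³ < 0`
  (✓ `key1_sum_strict`), so `e^{σx}F` is strictly decreasing.

Part 2 (`…ProductPlusOneRealRooted`) turns this into `Z₊(W(P)) ≤ B + B_mult ≤ 2·B_mult` and RUNG R-K3.  Honest framing: calculus on root sums;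
bounds no LINE decl by itself; NOT `WronskianBudgetK3` / `OneChangeFloorK3` / `stub_polyLaw` / `MatrixDescartes` / B; `VP ≠ VNP` NOT proved.
No definitions, no named facts; Mathlib + ✓ `…RealRootedKernel` only.
-/

set_option linter.dupNamespace false

namespace Summit.ValiantsHypothesis.ValiantsHypothesis.Theorems.LacunarySymmetroidMatrixDescartes

namespace ProductPlusOne

open Finset Set
open scoped BigOperators Topology

/-! ### §4 The window counts -/

/-- **Counting shell**: if `e^{σx}·f′` is strictly monotone on `(a,b)` then `f` has no three zeros there (Rolle twice). [folklore] -/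
theorem no_three_zeros_of_strictMonoOn_exp_mul_deriv {f f' : ℝ → ℝ} {a b σ : ℝ}
    (hf : ∀ x ∈ Ioo a b, HasDerivAt f (f' x) x)
    (hmono : StrictMonoOn (fun x => Real.exp (σ * x) * f' x) (Ioo a b))
    {x₁ x₂ x₃ : ℝ} (h₁ : x₁ ∈ Ioo a b) (h₃ : x₃ ∈ Ioo a b) (h12 : x₁ < x₂) (h23 : x₂ < x₃)
    (hz₁ : f x₁ = 0) (hz₂ : f x₂ = 0) (hz₃ : f x₃ = 0) : False := by
  have h₂ : x₂ ∈ Ioo a b := ⟨h₁.1.trans h12, h23.trans h₃.2⟩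
  have hsub12 : Icc x₁ x₂ ⊆ Ioo a b := fun t ht => ⟨h₁.1.trans_le ht.1, ht.2.trans_lt h₂.2⟩
  have hsub23 : Icc x₂ x₃ ⊆ Ioo a b := fun t ht => ⟨h₂.1.trans_le ht.1, ht.2.trans_lt h₃.2⟩
  have hcont : ∀ s, s ⊆ Ioo a b → ContinuousOn f s := fun s hs t ht =>
    (hf t (hs ht)).continuousAt.continuousWithinAt
  obtain ⟨c₁, hc₁, hfc₁⟩ := exists_hasDerivAt_eq_zero h12 (hcont _ hsub12) (hz₁.trans hz₂.symm)
    (fun t ht => hf t (hsub12 (Ioo_subset_Icc_self ht)))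
  obtain ⟨c₂, hc₂, hfc₂⟩ := exists_hasDerivAt_eq_zero h23 (hcont _ hsub23) (hz₂.trans hz₃.symm)
    (fun t ht => hf t (hsub23 (Ioo_subset_Icc_self ht)))
  have hc₁I : c₁ ∈ Ioo a b := hsub12 (Ioo_subset_Icc_self hc₁)
  have hc₂I : c₂ ∈ Ioo a b := hsub23 (Ioo_subset_Icc_self hc₂)
  have hlt : c₁ < c₂ := hc₁.2.trans hc₂.1
  have := hmono hc₁I hc₂I hlt
  simp [hfc₁, hfc₂] at this

/-- **Counting shell**: if `e^{σx}·f` is injective on a set then `f` has no two zeros there. [folklore] -/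
theorem no_two_zeros_of_injOn_exp_mul {f : ℝ → ℝ} {S : Set ℝ} {σ : ℝ}
    (hinj : Set.InjOn (fun x => Real.exp (σ * x) * f x) S)
    {x₁ x₂ : ℝ} (h₁ : x₁ ∈ S) (h₂ : x₂ ∈ S) (h12 : x₁ < x₂) (hz₁ : f x₁ = 0) (hz₂ : f x₂ = 0) : False := by
  have := hinj h₁ h₂ (by simp [hz₁, hz₂])
  exact absurd this (ne_of_lt h12)

/-- ★ **INNER WINDOW**: weights `w_i > 0`, roots `ρ_i ∉ (a,b)` with `0 < a`, some positive root `≤ a` and some root `≥ b`; then the root kernel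
`F(x) = Σ w_iρ_i/(x−ρ_i)²` has NO THREE ZEROS in `(a,b)`. [this file's theorem] -/
theorem rootKernel_inner_no_three_zeros {ι : Type*} (s : Finset ι) (w ρ : ι → ℝ) (hw : ∀ i ∈ s, 0 < w i)
    {a b : ℝ} (ha : 0 < a) (hab : a < b) (hρ : ∀ i ∈ s, ρ i ≤ a ∨ b ≤ ρ i)
    (hleft : ∃ i ∈ s, 0 < ρ i ∧ ρ i ≤ a) (hright : ∃ i ∈ s, b ≤ ρ i)
    {x₁ x₂ x₃ : ℝ} (h₁ : x₁ ∈ Ioo a b) (h₃ : x₃ ∈ Ioo a b) (h12 : x₁ < x₂) (h23 : x₂ < x₃)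
    (hz₁ : ∑ i ∈ s, w i * ρ i / (x₁ - ρ i) ^ 2 = 0) (hz₂ : ∑ i ∈ s, w i * ρ i / (x₂ - ρ i) ^ 2 = 0)
    (hz₃ : ∑ i ∈ s, w i * ρ i / (x₃ - ρ i) ^ 2 = 0) : False := by
  classical
  -- the left roots and the shift `σ`
  set L := s.filter (fun i => ρ i ≤ a) with hL
  have hwL : ∀ i ∈ L, 0 < w i := fun i hi => hw i (Finset.mem_of_mem_filter i hi)
  have hposL : ∃ i ∈ L, 0 < ρ i := by
    obtain ⟨i, hi, hρi, hia⟩ := hleft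
    exact ⟨i, Finset.mem_filter.2 ⟨hi, hia⟩, hρi⟩
  obtain ⟨σ, hσ0, hσ⟩ := exists_sigma L w ρ hwL hposL
  -- no root inside the window
  have hne : ∀ x ∈ Ioo a b, ∀ i ∈ s, x ≠ ρ i := by
    intro x hx i hi hxi
    rcases hρ i hi with h | h
    · exact absurd (hxi ▸ hx.1) (not_lt.2 h)
    · exact absurd (hxi ▸ hx.2) (not_lt.2 h)
  -- `F″ + σF′ > 0` on the window
  have hkey : ∀ x ∈ Ioo a b, 0 < ∑ i ∈ s, 6 * (w i * ρ i) / (x - ρ i) ^ 4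
      + σ * ∑ i ∈ s, -2 * (w i * ρ i) / (x - ρ i) ^ 3 := by
    intro x hx
    have hx0 : 0 < x := ha.trans hx.1
    have hcomb : ∑ i ∈ s, 6 * (w i * ρ i) / (x - ρ i) ^ 4 + σ * ∑ i ∈ s, -2 * (w i * ρ i) / (x - ρ i) ^ 3
        = ∑ i ∈ s, w i * ρ i * (6 - 2 * σ * (x - ρ i)) / (x - ρ i) ^ 4 := by
      rw [Finset.mul_sum, ← Finset.sum_add_distrib]
      refine Finset.sum_congr rfl fun i hi => ?_
      have hc : x - ρ i ≠ 0 := sub_ne_zero.2 (hne x hx i hi)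
      field_simp
      ring
    rw [hcomb, ← Finset.sum_filter_add_sum_filter_not s (fun i => ρ i ≤ a)]
    -- left part `≥ 0`
    have hleft0 : 0 ≤ ∑ i ∈ L, w i * ρ i * (6 - 2 * σ * (x - ρ i)) / (x - ρ i) ^ 4 := by
      have hρL : ∀ i ∈ L, ρ i < x := fun i hi => (Finset.mem_filter.1 hi).2.trans_lt hx.1
      have h2 := key2_sum L w ρ x σ hx0 hρL (fun i hi => (hwL i hi).le)
      rcases hσ with hg | ⟨hσe, hg0⟩
      · rw [hg, mul_zero] at h2; exact h2
      · subst hσe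
        have h6 : 0 ≤ (6 - 2 * (0 : ℝ) * x) / x ^ 4 := by
          have : (6 - 2 * (0 : ℝ) * x) = 6 := by ring
          rw [this]; positivity
        have hg0' : 0 ≤ ∑ i ∈ L, w i * ρ i * Real.exp (0 * ρ i) := by simpa using hg0
        exact (mul_nonneg h6 hg0').trans h2
    -- right part `> 0`
    have hright0 : 0 < ∑ i ∈ s.filter (fun i => ¬ ρ i ≤ a), w i * ρ i * (6 - 2 * σ * (x - ρ i)) / (x - ρ i) ^ 4 := by
      obtain ⟨j, hj, hjb⟩ := hright
      have hjR : j ∈ s.filter (fun i => ¬ ρ i ≤ a) := Finset.mem_filter.2 ⟨hj, not_le.2 (hab.trans_le hjb)⟩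
      refine Finset.sum_pos' (fun i hi => ?_) ⟨j, hjR, ?_⟩
      · obtain ⟨hi, hia⟩ := Finset.mem_filter.1 hi
        have hib : b ≤ ρ i := (hρ i hi).resolve_left hia
        have hρi : 0 < ρ i := (ha.trans hab).trans_le hib
        have hc : 0 < ρ i - x := sub_pos.2 (hx.2.trans_le hib)
        have hnum : 0 ≤ w i * ρ i * (6 - 2 * σ * (x - ρ i)) := by
          have : 6 - 2 * σ * (x - ρ i) = 6 + 2 * σ * (ρ i - x) := by ring
          rw [this]; exact mul_nonneg (mul_nonneg (hw i hi).le hρi.le) (by positivity)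
        have hden : 0 < (x - ρ i) ^ 4 := by
          have : (x - ρ i) ^ 4 = (ρ i - x) ^ 4 := by ring
          rw [this]; positivity
        exact div_nonneg hnum hden.le
      · have hρj : 0 < ρ j := (ha.trans hab).trans_le hjb
        have hc : 0 < ρ j - x := sub_pos.2 (hx.2.trans_le hjb)
        have hnum : 0 < w j * ρ j * (6 - 2 * σ * (x - ρ j)) := by
          have : 6 - 2 * σ * (x - ρ j) = 6 + 2 * σ * (ρ j - x) := by ring
          rw [this]; exact mul_pos (mul_pos (hw j hj) hρj) (by positivity)
        have hden : 0 < (x - ρ j) ^ 4 := by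
          have : (x - ρ j) ^ 4 = (ρ j - x) ^ 4 := by ring
          rw [this]; positivity
        exact div_pos hnum hden
    linarith
  -- `e^{σx}F′` is strictly increasing on the window
  have hF : ∀ x ∈ Ioo a b, HasDerivAt (fun t : ℝ => ∑ i ∈ s, w i * ρ i / (t - ρ i) ^ 2)
      (∑ i ∈ s, -2 * (w i * ρ i) / (x - ρ i) ^ 3) x := fun x hx => hasDerivAt_rootKernel_two s w ρ (hne x hx)
  have hmono : StrictMonoOn (fun x => Real.exp (σ * x) * ∑ i ∈ s, -2 * (w i * ρ i) / (x - ρ i) ^ 3) (Ioo a b) := by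
    refine strictMonoOn_of_deriv_pos (convex_Ioo a b) ?_ ?_
    · intro x hx
      have h1 : HasDerivAt (fun x => Real.exp (σ * x)) (Real.exp (σ * x) * (σ * 1)) x :=
        ((hasDerivAt_id' x).const_mul σ).exp
      exact (h1.fun_mul (hasDerivAt_rootKernel_three s w ρ (hne x hx))).continuousAt.continuousWithinAt
    · intro x hx
      rw [interior_Ioo] at hx
      have h1 : HasDerivAt (fun x => Real.exp (σ * x)) (Real.exp (σ * x) * (σ * 1)) x :=
        ((hasDerivAt_id' x).const_mul σ).exp
      rw [(h1.fun_mul (hasDerivAt_rootKernel_three s w ρ (hne x hx))).deriv]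
      have hpos := hkey x hx
      have hexp : 0 < Real.exp (σ * x) := Real.exp_pos _
      have : Real.exp (σ * x) * (σ * 1) * ∑ i ∈ s, -2 * (w i * ρ i) / (x - ρ i) ^ 3
          + Real.exp (σ * x) * ∑ i ∈ s, 6 * (w i * ρ i) / (x - ρ i) ^ 4
          = Real.exp (σ * x) * (∑ i ∈ s, 6 * (w i * ρ i) / (x - ρ i) ^ 4
              + σ * ∑ i ∈ s, -2 * (w i * ρ i) / (x - ρ i) ^ 3) := by ring
      rw [this]
      exact mul_pos hexp hpos
  exact no_three_zeros_of_strictMonoOn_exp_mul_deriv hF hmono h₁ h₃ h12 h23 hz₁ hz₂ hz₃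

/-- ★ **LEFT OUTER WINDOW**: weights `w_i > 0`, every root `≤ 0` or `≥ b` (`b > 0`), some root nonzero; then `F` has NO TWO ZEROS in `(0,b)`
(`F′ > 0` termwise). [this file's theorem] -/
theorem rootKernel_leftOuter_no_two_zeros {ι : Type*} (s : Finset ι) (w ρ : ι → ℝ) (hw : ∀ i ∈ s, 0 < w i)
    {b : ℝ} (hb : 0 < b) (hρ : ∀ i ∈ s, ρ i ≤ 0 ∨ b ≤ ρ i) (hne0 : ∃ i ∈ s, ρ i ≠ 0)
    {x₁ x₂ : ℝ} (h₁ : x₁ ∈ Ioo 0 b) (h₂ : x₂ ∈ Ioo 0 b) (h12 : x₁ < x₂)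
    (hz₁ : ∑ i ∈ s, w i * ρ i / (x₁ - ρ i) ^ 2 = 0) (hz₂ : ∑ i ∈ s, w i * ρ i / (x₂ - ρ i) ^ 2 = 0) : False := by
  have hne : ∀ x ∈ Ioo 0 b, ∀ i ∈ s, x ≠ ρ i := by
    intro x hx i hi hxi
    rcases hρ i hi with h | h
    · exact absurd (hxi ▸ hx.1) (not_lt.2 h)
    · exact absurd (hxi ▸ hx.2) (not_lt.2 h)
  have hmono : StrictMonoOn (fun t : ℝ => ∑ i ∈ s, w i * ρ i / (t - ρ i) ^ 2) (Ioo 0 b) := by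
    refine strictMonoOn_of_deriv_pos (convex_Ioo 0 b) ?_ ?_
    · exact fun x hx => (hasDerivAt_rootKernel_two s w ρ (hne x hx)).continuousAt.continuousWithinAt
    · intro x hx
      rw [interior_Ioo] at hx
      rw [(hasDerivAt_rootKernel_two s w ρ (hne x hx)).deriv]
      obtain ⟨j, hj, hj0⟩ := hne0
      refine Finset.sum_pos' (fun i hi => ?_) ⟨j, hj, ?_⟩
      · rcases hρ i hi with h | h
        · have hc : 0 < x - ρ i := by linarith [hx.1]
          have : 0 ≤ -2 * (w i * ρ i) := by nlinarith [(hw i hi).le]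
          positivity
        · have hc : 0 < ρ i - x := by linarith [hx.2]
          have hρi : 0 < ρ i := hb.trans_le h
          have h1 : -2 * (w i * ρ i) / (x - ρ i) ^ 3 = 2 * (w i * ρ i) / (ρ i - x) ^ 3 := by
            have : (x - ρ i) ^ 3 = -((ρ i - x) ^ 3) := by ring
            rw [this, div_neg]; ring
          rw [h1]
          exact (div_pos (by nlinarith [hw i hi]) (by positivity)).le
      · rcases hρ j hj with h | h
        · have hρj : ρ j < 0 := lt_of_le_of_ne h hj0
          have hc : 0 < x - ρ j := by linarith [hx.1]
          have : 0 < -2 * (w j * ρ j) := by nlinarith [hw j hj]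
          positivity
        · have hc : 0 < ρ j - x := by linarith [hx.2]
          have hρj : 0 < ρ j := hb.trans_le h
          have h1 : -2 * (w j * ρ j) / (x - ρ j) ^ 3 = 2 * (w j * ρ j) / (ρ j - x) ^ 3 := by
            have : (x - ρ j) ^ 3 = -((ρ j - x) ^ 3) := by ring
            rw [this, div_neg]; ring
          rw [h1]
          exact div_pos (by nlinarith [hw j hj]) (by positivity)
  have := hmono h₁ h₂ h12
  simp only [hz₁, hz₂, lt_self_iff_false] at this

/-- ★ **RIGHT OUTER WINDOW**: weights `w_i > 0`, every root `≤ a` (`a > 0`), some root positive; then `F` has NO TWO ZEROS in `(a,∞)`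
(`F′ + σF < 0`, so `e^{σx}F` is strictly decreasing). [this file's theorem] -/
theorem rootKernel_rightOuter_no_two_zeros {ι : Type*} (s : Finset ι) (w ρ : ι → ℝ) (hw : ∀ i ∈ s, 0 < w i)
    {a : ℝ} (ha : 0 < a) (hρ : ∀ i ∈ s, ρ i ≤ a) (hpos : ∃ i ∈ s, 0 < ρ i)
    {x₁ x₂ : ℝ} (h₁ : x₁ ∈ Ioi a) (h₂ : x₂ ∈ Ioi a) (h12 : x₁ < x₂)
    (hz₁ : ∑ i ∈ s, w i * ρ i / (x₁ - ρ i) ^ 2 = 0) (hz₂ : ∑ i ∈ s, w i * ρ i / (x₂ - ρ i) ^ 2 = 0) : False := by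
  obtain ⟨σ, hσ0, hσ⟩ := exists_sigma s w ρ hw hpos
  have hne : ∀ x ∈ Ioi a, ∀ i ∈ s, x ≠ ρ i := by
    intro x hx i hi hxi
    exact absurd (hxi ▸ hx) (not_lt.2 (hρ i hi))
  have hne0 : ∃ i ∈ s, ρ i ≠ 0 := by
    obtain ⟨i, hi, hρi⟩ := hpos
    exact ⟨i, hi, ne_of_gt hρi⟩
  -- `F′ + σF < 0` on `(a, ∞)`
  have hkey : ∀ x ∈ Ioi a, ∑ i ∈ s, -2 * (w i * ρ i) / (x - ρ i) ^ 3
      + σ * ∑ i ∈ s, w i * ρ i / (x - ρ i) ^ 2 < 0 := by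
    intro x hx
    have hx0 : 0 < x := ha.trans hx
    have hρx : ∀ i ∈ s, ρ i < x := fun i hi => (hρ i hi).trans_lt hx
    have hcomb : ∑ i ∈ s, -2 * (w i * ρ i) / (x - ρ i) ^ 3 + σ * ∑ i ∈ s, w i * ρ i / (x - ρ i) ^ 2
        = ∑ i ∈ s, w i * ρ i * (σ * (x - ρ i) - 2) / (x - ρ i) ^ 3 := by
      rw [Finset.mul_sum, ← Finset.sum_add_distrib]
      refine Finset.sum_congr rfl fun i hi => ?_
      have hc : x - ρ i ≠ 0 := sub_ne_zero.2 (hne x hx i hi)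
      field_simp
      ring
    rw [hcomb]
    have h1 := key1_sum_strict s w ρ x σ hx0 hρx hw hne0
    rcases hσ with hg | ⟨hσe, hg0⟩
    · rw [hg, mul_zero] at h1; exact h1
    · subst hσe
      have h2 : (0 * x - 2) / x ^ 3 * ∑ i ∈ s, w i * ρ i * Real.exp (0 * ρ i) ≤ 0 := by
        have hg0' : 0 ≤ ∑ i ∈ s, w i * ρ i * Real.exp (0 * ρ i) := by simpa using hg0
        have hc : (0 * x - 2) / x ^ 3 ≤ 0 := by
          have : (0 * x - 2) / x ^ 3 = -(2 / x ^ 3) := by ring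
          rw [this]; exact neg_nonpos.2 (by positivity)
        exact mul_nonpos_of_nonpos_of_nonneg hc hg0'
      exact h1.trans_le h2
  -- `e^{σx}F` strictly decreasing on `(a, ∞)`
  have hanti : StrictAntiOn (fun x => Real.exp (σ * x) * ∑ i ∈ s, w i * ρ i / (x - ρ i) ^ 2) (Ioi a) := by
    refine strictAntiOn_of_deriv_neg (convex_Ioi a) ?_ ?_
    · intro x hx
      have h1 : HasDerivAt (fun x => Real.exp (σ * x)) (Real.exp (σ * x) * (σ * 1)) x :=
        ((hasDerivAt_id' x).const_mul σ).exp
      exact (h1.fun_mul (hasDerivAt_rootKernel_two s w ρ (hne x hx))).continuousAt.continuousWithinAt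
    · intro x hx
      rw [interior_Ioi] at hx
      have h1 : HasDerivAt (fun x => Real.exp (σ * x)) (Real.exp (σ * x) * (σ * 1)) x :=
        ((hasDerivAt_id' x).const_mul σ).exp
      rw [(h1.fun_mul (hasDerivAt_rootKernel_two s w ρ (hne x hx))).deriv]
      have hneg := hkey x hx
      have hexp : 0 < Real.exp (σ * x) := Real.exp_pos _
      have : Real.exp (σ * x) * (σ * 1) * ∑ i ∈ s, w i * ρ i / (x - ρ i) ^ 2
          + Real.exp (σ * x) * ∑ i ∈ s, -2 * (w i * ρ i) / (x - ρ i) ^ 3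
          = Real.exp (σ * x) * (∑ i ∈ s, -2 * (w i * ρ i) / (x - ρ i) ^ 3
              + σ * ∑ i ∈ s, w i * ρ i / (x - ρ i) ^ 2) := by ring
      rw [this]
      exact mul_neg_of_pos_of_neg hexp hneg
  exact no_two_zeros_of_injOn_exp_mul hanti.injOn h₁ h₂ h12 hz₁ hz₂

end ProductPlusOne

end Summit.ValiantsHypothesis.ValiantsHypothesis.Theorems.LacunarySymmetroidMatrixDescartes
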